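import Literature.AnabelianGeometry.SemiGraphs.CharacteristicOpenCore
import Literature.AnabelianGeometry.SemiGraphs.PSCFundamentalGroup
import Literature.GroupTheory.ProPStronglyComplete
import Literature.GroupTheory.ProPPowerMap
import HarnessLib

/-!
# Characteristic open subgroups are cofinal in a topologically finitely generated pro-`p` group

J. D. Dixon, M. du Sautoy, A. Mann, D. Segal, *Analytic pro-`p` groups* (2nd ed., CUP 1999), Prop. 1.6
("every open subgroup [of a finitely generated profinite group] contains an open topologically
characteristic subgroup") with Thm. 1.17 (Serre: in a topologically finitely generated pro-`p` group every
finite-index subgroup is open, hence every abstract automorphism is continuous).  PROOF-ONLY file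
(abc-iut-f-164; Mathlib currency over the tree's `charOpenCore` of abc-iut-w4-d053,
`CharacteristicOpenCore.lean`, and abc-iut-w5-d218's Serre theorem `continuous_of_proP_of_finsetDense`,
`ProPStronglyComplete.lean`):

* `continuous_mulEquiv_of_proP` — abstract automorphisms of a topologically finitely generated pro-`p`
  group are continuous; hence `characteristic_charOpenCore_of_proP` — the characteristic open cores
  `charOpenCore Π d` (intersections of the open subgroups of index `≤ d`) are CHARACTERISTIC in Mathlib's
  abstract sense (`Subgroup.Characteristic`: fixed by every group automorphism), not only under
  bi-continuous ones;
* `exists_characteristic_isOpen_le_of_proP` — characteristic open subgroups are COFINAL among the open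
  subgroups; `mem_of_forall_characteristic_mem_sup` — a closed subgroup `C` is the intersection of the
  `C·U`, `U` characteristic open;
* bookkeeping: `isPGroup_quotient_of_isProSigma_singleton` (the PSC interface's `IsProSigma {p}` ⇒
  pro-`p` in the quotient form), `finsetDense_of_isTopologicallyFinitelyGenerated`.

Used by `PSCSmoothCurveCuspidalCharacterization.lean` ([IUTchI] Rmk. 1.2.3 (iv) at smooth-curve data:
the printed "for every characteristic open subgroup" is typed with Mathlib's abstract `Characteristic`,
and this file supplies enough such subgroups).  Nothing here refers to [IUTchIII] Cor. 3.12.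
[cite: DDMSAnalyticProP1999, Thm 1.17] [cite: DixonEtAl1999, Prop 1.6]
-/

namespace Literature.AnabelianGeometry.SemiGraphs

open Literature.AnabelianGeometry.AbsoluteAnabelian (IsTopologicallyFinitelyGenerated)

universe u

/-! ### A. Topologically finitely generated pro-`p` groups: characteristic open subgroups are cofinal -/

section ProP

variable {Q : Type u} [Group Q] [TopologicalSpace Q] [IsTopologicalGroup Q] [CompactSpace Q]
  [TotallyDisconnectedSpace Q] {p : ℕ} [Fact p.Prime]

omit [CompactSpace Q] [TotallyDisconnectedSpace Q] in
/-- The cell's `IsTopologicallyFinitelyGenerated` in the "finite subset generating a dense subgroup"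
form used by the tree's Serre theorem. [cite: MochizukiAbsTopI2012, §0 p.8] -/
theorem finsetDense_of_isTopologicallyFinitelyGenerated (hG : IsTopologicallyFinitelyGenerated Q) :
    ∃ S : Finset Q, Dense ((Subgroup.closure (S : Set Q) : Subgroup Q) : Set Q) := by
  obtain ⟨s, hs⟩ := hG.exists_finset
  refine ⟨s, ?_⟩
  rw [dense_iff_closure_eq, ← Subgroup.topologicalClosure_coe, hs, Subgroup.coe_top]

omit [TotallyDisconnectedSpace Q] [Fact p.Prime] in
/-- From the PSC interface's `IsProSigma {p}` ("every prime dividing the order of a finite continuous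
quotient is `p`") to "every finite continuous quotient is a `p`-group".
[cite: DDMSAnalyticProP1999, §1.2] -/
theorem isPGroup_quotient_of_isProSigma_singleton (hG : IsProSigma {p} Q) (U : OpenNormalSubgroup Q) :
    IsPGroup p (Q ⧸ (U : Subgroup Q)) := by
  refine Literature.GroupTheory.isPGroup_quotient_openNormalSubgroup_of_index
    (fun V => Literature.GroupTheory.exists_index_eq_pow_of_prime_dvd V fun q hq hqd => ?_) U
  haveI : Finite (Q ⧸ V.toSubgroup) := Subgroup.quotient_finite_of_isOpen V.toSubgroup V.isOpen
  exact hG.prime_mem V inferInstance q hq (by rwa [← Subgroup.index_eq_card])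

/-- **In a topologically finitely generated pro-`p` group every abstract automorphism is continuous**
(Serre's theorem, the tree's `continuous_of_proP_of_finsetDense`). [cite: DDMSAnalyticProP1999, Thm 1.17] -/
theorem continuous_mulEquiv_of_proP
    (hP : ∀ U : OpenNormalSubgroup Q, IsPGroup p (Q ⧸ (U : Subgroup Q)))
    (hfg : ∃ S : Finset Q, Dense ((Subgroup.closure (S : Set Q) : Subgroup Q) : Set Q))
    (φ : Q ≃* Q) : Continuous φ :=
  Literature.GroupTheory.continuous_of_proP_of_finsetDense hP hfg φ.toMonoidHom

/-- **The characteristic open cores of a topologically finitely generated pro-`p` group are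
CHARACTERISTIC** (fixed by every abstract automorphism — Mathlib's `Subgroup.Characteristic`), since
abstract automorphisms are bi-continuous and the cores are fixed by bi-continuous automorphisms
(abc-iut-w4-d053's `map_charOpenCore_eq`). [cite: DixonEtAl1999, Prop 1.6] -/
theorem characteristic_charOpenCore_of_proP
    (hP : ∀ U : OpenNormalSubgroup Q, IsPGroup p (Q ⧸ (U : Subgroup Q)))
    (hfg : ∃ S : Finset Q, Dense ((Subgroup.closure (S : Set Q) : Subgroup Q) : Set Q)) (d : ℕ) :
    (charOpenCore Q d).Characteristic :=
  Subgroup.characteristic_iff_map_eq.mpr fun φ =>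
    map_charOpenCore_eq φ (continuous_mulEquiv_of_proP hP hfg φ)
      (continuous_mulEquiv_of_proP hP hfg φ.symm)

/-- **Characteristic open subgroups are cofinal among the open subgroups of a topologically finitely
generated pro-`p` group**: every open `V` contains the characteristic open core of level `[Π : V]`,
which is characteristic and open. [cite: DixonEtAl1999, Prop 1.6] -/
theorem exists_characteristic_isOpen_le_of_proP
    (hP : ∀ U : OpenNormalSubgroup Q, IsPGroup p (Q ⧸ (U : Subgroup Q)))
    (htfg : IsTopologicallyFinitelyGenerated Q) (V : Subgroup Q) (hV : IsOpen (V : Set Q)) :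
    ∃ U : Subgroup Q, U ≤ V ∧ U.Characteristic ∧ IsOpen (U : Set Q) := by
  haveI : Finite (Q ⧸ V) := Subgroup.quotient_finite_of_isOpen V hV
  haveI : V.FiniteIndex := Subgroup.finiteIndex_of_finite_quotient
  exact ⟨charOpenCore Q V.index, charOpenCore_le_of_finiteIndex V hV,
    characteristic_charOpenCore_of_proP hP (finsetDense_of_isTopologicallyFinitelyGenerated htfg) _,
    isOpen_charOpenCore_of_tfg htfg _⟩

/-- **A closed subgroup of a topologically finitely generated pro-`p` group is the intersection of the
`C·U`, `U` characteristic open**: if `x ∈ C ⊔ U` for every characteristic open `U`, then `x ∈ C`.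
[cite: DixonEtAl1999, Prop 1.6] -/
theorem mem_of_forall_characteristic_mem_sup
    (hP : ∀ U : OpenNormalSubgroup Q, IsPGroup p (Q ⧸ (U : Subgroup Q)))
    (htfg : IsTopologicallyFinitelyGenerated Q) {C : Subgroup Q} (hC : IsClosed (C : Set Q)) {x : Q}
    (hx : ∀ U : Subgroup Q, U.Characteristic → IsOpen (U : Set Q) → x ∈ C ⊔ U) : x ∈ C := by
  by_contra hxC
  -- the closed set `{y | x * y⁻¹ ∈ C}` misses `1`; an open normal `V` avoiding it
  have hTc : IsClosed {y : Q | x * y⁻¹ ∈ C} :=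
    hC.preimage (continuous_const.mul continuous_inv)
  have h1 : (1 : Q) ∈ {y : Q | x * y⁻¹ ∈ C}ᶜ := by
    simpa only [Set.mem_compl_iff, Set.mem_setOf_eq, inv_one, mul_one] using hxC
  obtain ⟨V, hV⟩ := ProfiniteGrp.exist_openNormalSubgroup_sub_open_nhds_of_one hTc.isOpen_compl h1
  obtain ⟨U, hUV, hUchar, hUo⟩ :=
    exists_characteristic_isOpen_le_of_proP hP htfg (V : Subgroup Q) V.isOpen
  have hxV : x ∈ C ⊔ (V : Subgroup Q) := (sup_le_sup_left hUV C) (hx U hUchar hUo)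
  rw [← SetLike.mem_coe, Subgroup.mul_normal C (V : Subgroup Q)] at hxV
  obtain ⟨c, hc, v, hv, hcv⟩ := Set.mem_mul.mp hxV
  have hvT : v ∈ {y : Q | x * y⁻¹ ∈ C} := by
    show x * v⁻¹ ∈ C
    rw [← hcv, mul_inv_cancel_right]
    exact hc
  exact hV hv hvT

end ProP

end Literature.AnabelianGeometry.SemiGraphs
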